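import Literature.AlgebraicGeometry.Resolution.VertexBlowupProjectionSmooth
import Literature.AlgebraicGeometry.Resolution.ProjHomogeneousIdealSheaf
import Literature.AlgebraicGeometry.Resolution.BlowupPrincipalCharts
import Literature.AlgebraicGeometry.Resolution.ExceptionalDivisorProjectiveBundle
import Literature.AlgebraicGeometry.Resolution.CobordantBlowup
import Literature.AlgebraicGeometry.Resolution.HypersurfaceTransform
import Literature.AlgebraicGeometry.Hironaka2017.Lib.PAlgLocality
import Literature.AlgebraicGeometry.Motives.ProjectiveSpaceDehomogenize
import HarnessLib

/-!
# Crux `PatchingRelPerfect` (stmt-ResolutionOfSingularities-16161), chain W5.2 — TargetsF4 §5 E-side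
# `ConeVertexResolvable ℓ`: the cone over a projective hypersurface and the blowing up of the vertex, CHART LEMMAS

[OURS · L1 W5.2 · TargetsF4 §5 support] Pure PROOFS (no definitions, no named facts). For a field `κ₀`, a form
`F ∈ κ₀[y₀, …, y_m]` of degree `ℓ` and its CONE `G = F(x₀, …, x_m) ∈ κ₀[x₀, …, x_{m+1}]` (the same form, not
involving the last variable), this file reads the ideal sheaves `(F)~ ⊆ 𝒪_{ℙ^m}` and `(G)~ ⊆ 𝒪_{ℙ^{m+1}}`
(F4 `DepthTargets.formsIdealSheaf κ₀ _ ℓ (fun _ : Fin 1 => ·) _`, written out as the tree's `projIdealSheaf`) on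
the charts of the tree's de Jong 1996 Lemma 4.11 package — `ℙ^{m+1}` with its vertex `v = (0 : … : 0 : 1)`
(`DeJong1996.vertex`), the reduced ideal `𝓘_v` (`DeJong1996.vertexIdealSheaf`), the last chart
`D₊(x_{m+1}) ≅ Spec κ₀[X₀, …, X_m]` (`DeJong1996.lastChartEquiv`), the charts `Spec κ₀[X][I/Xᵢ] → P̃` of ANY
blowing up `b : P̃ → ℙ^{m+1}` of the vertex (`DeJong1996.vertexChart`) and the chart ring maps of the linear
projection from the vertex (`DeJong1996.vertexProjectionRingHom`, `PointBlowup.projRingHom`):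

* `comap_awayι_projIdealSheaf_span` — on `Spec (A_s)₀ = D₊(s)`, `deg s = 1`, the ideal sheaf of `(z_l)_l`
  pulls back to `(z_l / s^{N_l})~` (general `Proj`, from `projIdealSheaf_ideal_basicOpen_span`);
* `vertexProjectionRingHom_mk₁` — `pr_v^* (F / y_j^ℓ) = G / x_j^ℓ` on `D₊(x_j)`, `j ≤ m`;
* `algebraMap_eq_exc_pow_mul_projRingHom_mk₁` — `F(X) = Xᵢ^ℓ · q^*(F / y_i^ℓ)` in `κ₀[X][I/Xᵢ]`;
* `lastChartEquiv_awayToSection_mk₁` — `G / x_{m+1}^ℓ` read in `κ₀[X₀, …, X_m]` is `F(X)`;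
* `colon_idealSheaf_span_mul` — `((a·x)~ : (a)~) = (x)~` for a non-zero-divisor `a` (affine schemes);
* `comap_chartι_vertexIdealSheaf` — `𝓘_v` is the unit ideal on `D₊(x_j)`, `j ≤ m`;
* `mem_range_fst_or_mem_range_vertexChart` — the charts over the vertex and the pieces over `D₊(x_j)`,
  `j ≤ m`, cover `P̃`;
* **`projIdealSheaf_cone_le_vertexIdealSheaf_pow` — `(G)~ ≤ 𝓘_v^ℓ`**: the cone is weight-`ℓ`-permissible at its
  vertex (the hypothesis `𝔟 ≤ C^ℓ` of `DepthTargets.IsPureWeightedSeq.cons`).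

The transform identity `(b^*(G)~ : 𝓘_E^ℓ) = q^*(F)~` and its corollaries (order `≤ 1` everywhere, local
principality) are in the sequel `…DepthConeVertexTransform`; the by-name closer `coneVertexResolvable_holds` is
res-type-003's assembly. AI-written; AI review is weaker than expert review. Nothing here is a statement of the
manuscript under review.

## References
* A. J. de Jong, *Smoothness, semi-stability and alterations*, Publ. Math. IHÉS 83 (1996), proof of Lemma 4.11,
  p. 68. [DeJong1996]
* R. Hartshorne, *Algebraic Geometry* (1977), II Prop. 2.5 (b), II Prop. 5.11 (b), II Thm. 8.24. [Hartshorne1977]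
* E. Bierstone, D. Grigoriev, P. Milman, J. Włodarczyk, *Effective Hironaka resolution and its complexity*, Asian J.
  Math. 15 (2011), Def. 3.1.3, §3.2. [BierstoneGrigorievMilmanWlodarczyk2011]
* The Stacks Project, Tag 0804 (affine blow-up algebras and their charts). [StacksProject]
-/

-- `Summit.<Summit>.<Sub>.Theorems` with `Sub = Summit` (single-conjunct summit, D-0017)
set_option linter.dupNamespace false

noncomputable section

open CategoryTheory CategoryTheory.Limits AlgebraicGeometry TopologicalSpace HomogeneousLocalization
open Literature.AlgebraicGeometry.Resolution Literature.AlgebraicGeometry.Motives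
open Literature.AlgebraicGeometry.Hironaka2017

attribute [local instance] MvPolynomial.gradedAlgebra

namespace Summit.ResolutionOfSingularities.ResolutionOfSingularities.Theorems.DepthCone

universe u

open Literature.AlgebraicGeometry.Motives.Segre (grading chartι X_mem frac cst)
open DeJong1996

/-! ## Ideal sheaves of homogeneous ideals on the standard charts -/

/-- Cancelling an isomorphism of affine schemes in a pull-back of ideal sheaves. [folklore] -/
theorem comap_SpecMap_hom_injective {A B : CommRingCat.{u}} (e : A ≅ B)
    {K K' : (Spec A).IdealSheafData}
    (h : K.comap (Spec.map e.hom) = K'.comap (Spec.map e.hom)) : K = K' := by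
  have hK : ∀ L : (Spec A).IdealSheafData, (L.comap (Spec.map e.hom)).comap (Spec.map e.inv) = L := by
    intro L
    rw [← Scheme.IdealSheafData.comap_comp, ← Spec.map_comp, e.hom_inv_id, Spec.map_id,
      Scheme.IdealSheafData.comap_id]
  rw [← hK K, ← hK K', h]

/-- **Pull-back of `Ĩ` to a chart of degree one**: over `Spec (A_s)₀ = D₊(s) ⊆ Proj A` (`deg s = 1`), the
ideal sheaf of the homogeneous ideal generated by forms `z_l` of degrees `N_l` pulls back along `awayι` to the
ideal sheaf of the ideal `(z_l / s^{N_l})_l ⊆ (A_s)₀` of dehomogenized forms.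
[cite: Hartshorne1977, II Prop. 5.11 (b) (proof)] -/
theorem comap_awayι_projIdealSheaf_span {R A : Type u} [CommRing R] [CommRing A] [Algebra R A]
    (𝒜 : ℕ → Submodule R A) [GradedAlgebra 𝒜] {ι' : Type*} (z : ι' → A) (N : ι' → ℕ)
    (hz : ∀ l, z l ∈ 𝒜 (N l)) {s : A} (hs : s ∈ 𝒜 1) :
    (projIdealSheaf 𝒜 ⟨Ideal.span (Set.range z), isHomogeneous_span_of_forall_mem 𝒜 z N hz⟩).comap
        (Proj.awayι 𝒜 s hs one_pos) =
      affineBlowup.idealSheaf (Ideal.span (Set.range fun l => mk₁ 𝒜 hs (N l) (z l) (hz l))) := by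
  set K := projIdealSheaf 𝒜 ⟨Ideal.span (Set.range z), isHomogeneous_span_of_forall_mem 𝒜 z N hz⟩
  have h1 := comap_fromSpec K (ProjSubscheme.affineBasicOpen 𝒜 s hs one_pos)
  rw [ProjSubscheme.fromSpec_affineBasicOpen, Scheme.IdealSheafData.comap_comp,
    projIdealSheaf_ideal_basicOpen_span 𝒜 z N hz _ hs] at h1
  have h3 : Ideal.span (Set.range fun l => (Proj.awayToSection 𝒜 s).hom (mk₁ 𝒜 hs (N l) (z l) (hz l))) =
      (Ideal.span (Set.range fun l => mk₁ 𝒜 hs (N l) (z l) (hz l))).map (Proj.awayToSection 𝒜 s).hom := by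
    rw [Ideal.map_span, ← Set.range_comp]
    rfl
  have h2 : Spec.map (Proj.awayToSection 𝒜 s) =
      Spec.map (CommRingCat.ofHom (Proj.awayToSection 𝒜 s).hom) := rfl
  rw [h3, h2, ← comap_idealSheaf_specMap, ← h2] at h1
  exact comap_SpecMap_hom_injective (Proj.basicOpenIsoAway 𝒜 s hs one_pos) h1


/-- Dehomogenized forms: `p / x_aⁿ = p(x/x_a)` in `(k[x]_{(x_a)})₀`, in the spelling `mk₁` of
`ProjHomogeneousIdealSheaf`. [folklore] -/
theorem mk₁_eq_eval₂Hom {ι : Type} (κ₀ : Type u) [Field κ₀] (a : ι) (n : ℕ) (p : MvPolynomial ι κ₀)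
    (hp : p ∈ grading ι κ₀ n) :
    mk₁ (grading ι κ₀) (X_mem κ₀ a) n p hp =
      MvPolynomial.eval₂Hom (cst κ₀ (MvPolynomial.X a)) (frac κ₀ a) p := by
  unfold mk₁
  exact Segre.awayMk_eq_eval₂ κ₀ a n p _

variable (κ₀ : Type u) [Field κ₀] (m ℓ : ℕ)

/-- **The cone on the charts off the vertex**: the linear projection `y_a/y_j ↦ x_a/x_j` carries the
dehomogenized form `F / y_j^ℓ` of `ℙ^m` to the dehomogenized cone `G / x_j^ℓ` of `ℙ^{m+1}`,
`G = F(x₀, …, x_m)`. [folklore] -/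
theorem vertexProjectionRingHom_mk₁ (j : Fin (m + 1)) (F : MvPolynomial (Fin (m + 1)) κ₀)
    (hF : F ∈ grading (Fin (m + 1)) κ₀ ℓ)
    (hG : MvPolynomial.rename Fin.castSucc F ∈ grading (Fin (m + 1 + 1)) κ₀ ℓ) :
    vertexProjectionRingHom m κ₀ j (mk₁ (grading (Fin (m + 1)) κ₀) (X_mem κ₀ j) ℓ F hF) =
      mk₁ (grading (Fin (m + 1 + 1)) κ₀) (X_mem κ₀ (Fin.castSucc j)) ℓ
        (MvPolynomial.rename Fin.castSucc F) hG := by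
  rw [mk₁_eq_eval₂Hom, mk₁_eq_eval₂Hom, MvPolynomial.eval₂Hom_rename, ← RingHom.comp_apply,
    MvPolynomial.comp_eval₂Hom, vertexProjectionRingHom_comp_cst]
  congr 2
  funext a
  exact vertexProjectionRingHom_frac m κ₀ j a

/-- **The cone on the charts over the vertex**: in the chart ring `Cᵢ = k[X][I/Xᵢ]` of the blowing up of
`𝔸^{m+1} = D₊(x_{m+1})` in the origin, `F(X) = Xᵢ^ℓ · F(X/Xᵢ)` and `F(X/Xᵢ)` is the image of `F / y_i^ℓ`
under the chart ring map `y_a/y_i ↦ X_a/Xᵢ` of the projection. [folklore] -/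
theorem algebraMap_eq_exc_pow_mul_projRingHom_mk₁ (i : Fin (m + 1)) (F : MvPolynomial (Fin (m + 1)) κ₀)
    (hF : F ∈ grading (Fin (m + 1)) κ₀ ℓ) :
    algebraMap (PointBlowup.R m κ₀) (PointBlowup.Chart m κ₀ i) F =
      PointBlowup.exc m κ₀ i ^ ℓ *
        PointBlowup.projRingHom m κ₀ i (mk₁ (grading (Fin (m + 1)) κ₀) (X_mem κ₀ i) ℓ F hF) := by
  rw [mk₁_eq_eval₂Hom, ← RingHom.comp_apply, MvPolynomial.comp_eval₂Hom,
    PointBlowup.projRingHom_comp_cst]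
  have h1 : algebraMap (PointBlowup.R m κ₀) (PointBlowup.Chart m κ₀ i) =
      MvPolynomial.eval₂Hom (algebraMap κ₀ (PointBlowup.Chart m κ₀ i))
        fun j => PointBlowup.exc m κ₀ i * PointBlowup.frac m κ₀ i j := by
    refine MvPolynomial.ringHom_ext (fun c => ?_) (fun j => ?_)
    · rw [MvPolynomial.eval₂Hom_C, ← MvPolynomial.algebraMap_eq,
        ← IsScalarTower.algebraMap_apply κ₀ (PointBlowup.R m κ₀) (PointBlowup.Chart m κ₀ i) c]
    · rw [MvPolynomial.eval₂Hom_X', PointBlowup.algebraMap_X]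
  rw [h1, MvPolynomial.coe_eval₂Hom, MvPolynomial.coe_eval₂Hom,
    Segre.eval₂_mul_left_of_isHomogeneous _ _ _ ((MvPolynomial.mem_homogeneousSubmodule _ _).mp hF)]
  congr 2
  funext j
  exact (PointBlowup.projRingHom_frac m κ₀ i j).symm

/-- **The cone on the last chart**: the dehomogenized cone `G / x_{m+1}^ℓ`, read in
`Γ(D₊(x_{m+1})) ≅ k[X₀, …, X_m]`, is `F(X)` itself. [folklore] -/
theorem lastChartEquiv_awayToSection_mk₁ (F : MvPolynomial (Fin (m + 1)) κ₀)
    (hG : MvPolynomial.rename Fin.castSucc F ∈ grading (Fin (m + 1 + 1)) κ₀ ℓ) :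
    lastChartEquiv m κ₀ (Proj.awayToSection (grading (Fin (m + 1 + 1)) κ₀) (MvPolynomial.X (Fin.last (m + 1)))
      (mk₁ (grading (Fin (m + 1 + 1)) κ₀) (X_mem κ₀ (Fin.last (m + 1))) ℓ
        (MvPolynomial.rename Fin.castSucc F) hG)) = F := by
  rw [lastChartEquiv_awayToSection]
  change ProjectiveSpace.ofChartRingHom κ₀ (Fin.last (m + 1)) (Away.mk _ _ ℓ _ _) = F
  rw [ProjectiveSpace.ofChartRingHom_mk, ← Fin.succAbove_last]
  exact ProjectiveSpace.dehomogenize_rename_succAbove κ₀ (Fin.last (m + 1)) F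


/-- **Cancelling a non-zero-divisor in a colon ideal sheaf on an affine scheme**: `((a·x)~ : (a)~) = (x)~`.
[folklore] -/
theorem colon_idealSheaf_span_mul {R : Type u} [CommRing R] {a : R} (ha : a ∈ nonZeroDivisors R) (x : R) :
    colon (affineBlowup.idealSheaf (Ideal.span {a * x})) (affineBlowup.idealSheaf (Ideal.span {a})) =
      affineBlowup.idealSheaf (Ideal.span {x}) := by
  unfold affineBlowup.idealSheaf
  rw [colon_ofIdealTop]
  congr 1
  set ι := (Scheme.ΓSpecIso (.of R)).inv.hom with hι
  rw [Ideal.map_span, Ideal.map_span, Ideal.map_span, Set.image_singleton, Set.image_singleton,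
    Set.image_singleton, map_mul]
  have ha' : ι a ∈ nonZeroDivisors _ :=
    mem_nonZeroDivisors_of_injective (f := (Scheme.ΓSpecIso (.of R)).hom.hom)
      (Scheme.ΓSpecIso (.of R)).commRingCatIsoToRingEquiv.injective
      (by rwa [hι, ← CommRingCat.comp_apply, Iso.inv_hom_id, CommRingCat.id_apply])
  exact colon_span_mul_span_singleton ha' (ι x)


/-- **The vertex is off the charts `D₊(x_j)`, `j ≤ m`**: the ideal of the vertex pulls back to the unit
ideal along `D₊(x_j) ↪ ℙ^{m+1}`. [folklore] -/
theorem comap_chartι_vertexIdealSheaf (j : Fin (m + 1)) :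
    (vertexIdealSheaf m κ₀).comap (chartι κ₀ (Fin.castSucc j)) = ⊤ := by
  rw [← Scheme.IdealSheafData.support_eq_bot_iff, eq_bot_iff]
  intro x hx
  rw [Scheme.IdealSheafData.support_comap] at hx
  have hx' : chartι κ₀ (Fin.castSucc j) x ∈ ((vertexIdealSheaf m κ₀).support : Set _) := hx
  rw [Scheme.IdealSheafData.coe_support_vanishingIdeal] at hx'
  have h : chartι κ₀ (Fin.castSucc j) x = vertex m κ₀ := hx'
  exfalso
  apply vertex_notMem_basicOpen m κ₀ j
  rw [← h, ← Proj.opensRange_awayι _ _ (X_mem κ₀ (Fin.castSucc j)) zero_lt_one]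
  exact ⟨x, rfl⟩

/-- **The two families of charts cover the blow-up**: every point of `P̃` lies over some `D₊(x_j)`, `j ≤ m`
(in the range of `P̃ ×_{ℙ^{m+1}} D₊(x_j) → P̃`), or in the range of some chart `Spec Cᵢ → P̃` over
`D₊(x_{m+1})`. [folklore] -/
theorem mem_range_fst_or_mem_range_vertexChart {P : Scheme.{u}} {b : P ⟶ ProjSpace.P (m + 1) κ₀}
    (hb : IsBlowup b (vertexIdealSheaf m κ₀)) (x : P) :
    (∃ j : Fin (m + 1), x ∈ Set.range (pullback.fst b (chartι κ₀ (Fin.castSucc j)))) ∨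
      ∃ i : Fin (m + 1), x ∈ Set.range (vertexChart hb i) := by
  rcases mem_preimage_basicOpen_or_mem_opensRange hb x with ⟨j, hj⟩ | ⟨i, hi⟩
  · refine Or.inl ⟨j, ?_⟩
    rw [Scheme.Pullback.range_fst]
    change b x ∈ Set.range (chartι κ₀ (Fin.castSucc j))
    rw [← Scheme.Hom.coe_opensRange, Proj.opensRange_awayι _ _ (X_mem κ₀ (Fin.castSucc j)) zero_lt_one]
    exact hj
  · exact Or.inr ⟨i, hi⟩



/-! ## The cone is weight-`ℓ`-permissible at the vertex -/

/-- A form of degree `n` lies in the `n`-th power of the ideal of the variables. [folklore] -/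
theorem mem_span_X_pow_of_isHomogeneous {σ R : Type*} [CommRing R] {F : MvPolynomial σ R} {n : ℕ}
    (hF : F.IsHomogeneous n) :
    F ∈ Ideal.span (Set.range (MvPolynomial.X : σ → MvPolynomial σ R)) ^ n := by
  classical
  have key : ∀ (d : σ →₀ ℕ) (s : Finset σ),
      (∏ i ∈ s, (MvPolynomial.X i : MvPolynomial σ R) ^ d i) ∈
        Ideal.span (Set.range (MvPolynomial.X : σ → MvPolynomial σ R)) ^ (∑ i ∈ s, d i) := by
    intro d s
    induction s using Finset.induction_on with
    | empty => simp
    | insert a s ha ih =>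
      rw [Finset.prod_insert ha, Finset.sum_insert ha, pow_add]
      exact Ideal.mul_mem_mul (Ideal.pow_mem_pow (Ideal.subset_span (Set.mem_range_self a)) _) ih
  rw [F.as_sum]
  refine Ideal.sum_mem _ fun d hd => ?_
  have hdn : d.degree = n := by
    rw [Finsupp.degree_eq_weight_one]
    exact hF (MvPolynomial.mem_support_iff.mp hd)
  rw [MvPolynomial.monomial_eq]
  refine Ideal.mul_mem_left _ _ ?_
  rw [← hdn, Finsupp.degree, Finsupp.prod]
  exact key d d.support

/-- **The cone is weight-`ℓ`-permissible at the vertex**: `(G)~ ≤ 𝓘_v^ℓ` for the cone `G = F(x₀, …, x_m)` over a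
form `F` of degree `ℓ` (on `D₊(x_{m+1}) ≅ Spec κ₀[X₀, …, X_m]` this is `F(X) ∈ (X₀, …, X_m)^ℓ`; off the vertex the
right-hand side is the unit ideal) — the permissibility hypothesis of the pure weight-`ℓ` step.
[cite: BierstoneGrigorievMilmanWlodarczyk2011, Def. 3.1.3 (1)] -/
theorem projIdealSheaf_cone_le_vertexIdealSheaf_pow
    (F : MvPolynomial (Fin (m + 1)) κ₀) (hF : F ∈ MvPolynomial.homogeneousSubmodule (Fin (m + 1)) κ₀ ℓ)
    {G : MvPolynomial (Fin (m + 1 + 1)) κ₀} (hG : G ∈ MvPolynomial.homogeneousSubmodule (Fin (m + 1 + 1)) κ₀ ℓ)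
    (hGF : G = MvPolynomial.rename Fin.castSucc F) :
    projIdealSheaf (MvPolynomial.homogeneousSubmodule (Fin (m + 1 + 1)) κ₀)
        ⟨Ideal.span (Set.range fun _ : Fin 1 => G),
          isHomogeneous_span_of_forall_mem _ _ (fun _ => ℓ) fun _ => hG⟩ ≤
      vertexIdealSheaf m κ₀ ^ ℓ := by
  subst hGF
  -- cover `ℙ^{m+1}` by the last chart and the charts `D₊(x_j)`, `j ≤ m`
  let Y : Option (Fin (m + 1)) → Scheme.{u} := fun o =>
    match o with
    | none => Spec Γ(ProjSpace.P (m + 1) κ₀, (lastChart m κ₀ : (ProjSpace.P (m + 1) κ₀).Opens))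
    | some j => Spec (CommRingCat.of (Away (grading (Fin (m + 1 + 1)) κ₀) (MvPolynomial.X (Fin.castSucc j))))
  let g : ∀ o, Y o ⟶ ProjSpace.P (m + 1) κ₀ := fun o =>
    match o with
    | none => (lastChart m κ₀).2.fromSpec
    | some j => chartι κ₀ (Fin.castSucc j)
  haveI hg : ∀ o, IsOpenImmersion (g o) := fun o =>
    match o with
    | none => inferInstanceAs (IsOpenImmersion (lastChart m κ₀).2.fromSpec)
    | some j => inferInstanceAs (IsOpenImmersion (chartι κ₀ (Fin.castSucc j)))
  have hcov : ∀ x : ProjSpace.P (m + 1) κ₀, ∃ o ∈ (Set.univ : Set (Option (Fin (m + 1)))),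
      x ∈ Set.range (g o) := by
    intro x
    have hx : x ∈ (⊤ : (ProjSpace.P (m + 1) κ₀).Opens) := trivial
    rw [← puncturedSpace_sup_lastChart m κ₀, Opens.mem_sup] at hx
    rcases hx with hx | hx
    · rw [puncturedSpace, Opens.mem_iSup] at hx
      obtain ⟨j, hj⟩ := hx
      refine ⟨some j, Set.mem_univ _, ?_⟩
      change x ∈ Set.range (chartι κ₀ (Fin.castSucc j))
      rw [← Scheme.Hom.coe_opensRange, Proj.opensRange_awayι _ _ (X_mem κ₀ (Fin.castSucc j)) zero_lt_one]
      exact hj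
    · refine ⟨none, Set.mem_univ _, ?_⟩
      change x ∈ Set.range (lastChart m κ₀).2.fromSpec
      rw [IsAffineOpen.range_fromSpec]
      exact hx
  refine S02Preliminaries.le_of_forall_comap_le Set.univ g hcov fun o _ => ?_
  match o with
  | some j =>
    change _ ≤ (vertexIdealSheaf m κ₀ ^ ℓ).comap (chartι κ₀ (Fin.castSucc j))
    rw [comap_pow, comap_chartι_vertexIdealSheaf, ← Scheme.IdealSheafData.one_eq_top, one_pow]
    exact le_top
  | none =>
    change Scheme.IdealSheafData.comap _ (lastChart m κ₀).2.fromSpec ≤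
      (vertexIdealSheaf m κ₀ ^ ℓ).comap (lastChart m κ₀).2.fromSpec
    rw [comap_fromSpec, comap_fromSpec,
      projIdealSheaf_ideal_basicOpen_span _ _ (fun _ => ℓ) (fun _ => hG) _ (X_mem κ₀ (Fin.last (m + 1))),
      Scheme.IdealSheafData.ideal_pow, Pi.pow_apply]
    refine idealSheaf_mono ?_
    rw [Ideal.span_le, Set.range_subset_iff]
    intro _
    rw [SetLike.mem_coe, ← Ideal.comap_map_of_bijective (lastChartEquiv m κ₀).toRingHom
      ((lastChartEquiv m κ₀).bijective : Function.Bijective (lastChartEquiv m κ₀).toRingHom)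
      (I := (vertexIdealSheaf m κ₀).ideal (lastChart m κ₀) ^ ℓ), Ideal.mem_comap, Ideal.map_pow,
      map_vanishingIdeal_vertex_ideal_lastChart, RingEquiv.toRingHom_eq_coe, RingEquiv.coe_toRingHom,
      lastChartEquiv_awayToSection_mk₁]
    exact mem_span_X_pow_of_isHomogeneous ((MvPolynomial.mem_homogeneousSubmodule _ _).mp hF)

end Summit.ResolutionOfSingularities.ResolutionOfSingularities.Theorems.DepthCone

end
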